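import Summits.RiemannHypothesis.RiemannHypothesis.Theorems.HandoffBottomDropProof
import Summits.RiemannHypothesis.RiemannHypothesis.Theorems.HandoffPrimeShadow
import HarnessLib

/-!
# HANDOFF — the arithmetic shadow as a CRITERION: `RH ⟺` the smoothed Chebyshev sums of every narrow bump stay below their main term
# (rh-explicit, TRACK «HANDOFF», seat prove-2 gen4, ATTEMPT-11 §2)

HONEST FRAMING. Nothing here is a step towards RH. This file closes the logical loop around `HandoffPrimeShadow.lean`:

* window side (`HandoffPrimeShadow.abs_chebyshev_sub_main_le`): `WeilPositivityOn (L/2 + r)` gives the TWO-sided bound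
  `|S_ψ(L) − M_ψ(L)| ≤ Re Q(ψ) + (exp-small)` for every bump `ψ` of radius `r` and every `L > 2r`;
* RH side (here, `riemannHypothesis_iff_oneSidedShadow`): **`RH ⟺` for every bump `ψ` of radius `≤ 1/16` the ONE-sided bound
  `S_ψ(log x) ≤ M_ψ(log x) + K₀(ψ)` holds for all large `x`** — (⟹) through `RH ⟹ WeilPositivityOn` and the window side (or theory-2's
  `comparison_nonneg`), (⟸) by theory-2's PRIME-SIDE Landau endgame (`HandoffBottomDropProof` §2–§4 + prove-1's
  `false_of_mellin_eq_logDerivZeta`): an off-line zero makes `M_ψ − S_ψ` change sign without bound for every sufficiently narrow bump.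
  In content this is Landau's one-signed-oscillation theorem for `ψ(x) − x` (MV 2007 Thm 15.2/15.3) in the smoothed `n^{−1/2}`-weighted dress
  of this track; what is specific to the track is the reading: the handoff ladder `H(q)`, `q = 2, 3, 5, …`, certifies EXACTLY the finite
  families `{|S_ψ(L) − M_ψ(L)| ≤ Q(ψ) : L + 2r ≤ log q⁺}` of these inequalities, and `RH` is their union over all `L` — with the same
  fluctuation constant on both sides.

References: Montgomery–Vaughan (2007) §15.1 Lemma 15.1, Thm 15.2 (`MontgomeryVaughan2007`); Bombieri (2000) Thm 2 (`Bombieri2000Weil`).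
NO new definitions.
-/

set_option linter.dupNamespace false  -- the mandated namespace repeats `RiemannHypothesis`

noncomputable section

open Set Filter Complex MeasureTheory Literature.NumberTheory.LFunctions
open Literature.NumberTheory.LFunctions.Landau
open Summit.RiemannHypothesis.RiemannHypothesis.Theorems.Handoff
open Summit.RiemannHypothesis.RiemannHypothesis.Theorems.HandoffCapSharp (integral_bump_sq_pos)
open Summit.RiemannHypothesis.RiemannHypothesis.Theorems.HandoffBumpAutocorr
open Summit.RiemannHypothesis.RiemannHypothesis.Theorems.HandoffDipoleChebyshev
open Summit.RiemannHypothesis.RiemannHypothesis.Theorems.HandoffChebyshevMellin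
open Summit.RiemannHypothesis.RiemannHypothesis.Theorems.HandoffBottomDropProof
open Summit.RiemannHypothesis.RiemannHypothesis.Theorems.HandoffDecomposition
open scoped Real ComplexConjugate ArithmeticFunction.vonMangoldt

namespace Summit.RiemannHypothesis.RiemannHypothesis.Theorems.HandoffPrimeShadow

/-- **(⟸) An eventual ONE-SIDED shadow for every narrow bump forces RH.** If for every bump `ψ` at `0` of outer radius `≤ 1/16` the real
smoothed sum `F_ψ(x) = Σ_n Λ(n)n^{−1/2}φ_ψ(log n − log x)` satisfies `F_ψ(x) ≤ K₀ + Re φ̂_ψ(1)·(√x + 1/√x)` for all `x > X₁` (some `K₀`, `X₁ ≥ 1`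
depending on `ψ`), then RH holds. (Contrapositive = theory-2's prime-side Lemma L with the window bottom replaced by the Chebyshev side:
a right-most off-line zero `ρ₀` is a pole of the Mellin transform of the one-signed comparison function at which `φ̂(ρ₀) ≠ 0` once
`4r|ρ₀ − ½| < 1`.) [cite: MontgomeryVaughan2007, §15.1 Thm 15.2 (method); this track, ATTEMPT-11 §2] -/
theorem riemannHypothesis_of_oneSidedShadow
    (h : ∀ ψ : ContDiffBump (0 : ℝ), ψ.rOut ≤ 1 / 16 → ∃ K₀ X₁ : ℝ, 1 ≤ X₁ ∧ ∀ x : ℝ, X₁ < x →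
      (fun x : ℝ ↦ ∑' n : ℕ, (Λ n : ℝ) / Real.sqrt n * (∫ u : ℝ, ψ u * ψ (u - (Real.log n - Real.log x)))) x ≤
        K₀ + (weilMellin (weilConv (fun x : ℝ ↦ ((ψ x : ℝ) : ℂ)) (weilReflect fun x : ℝ ↦ ((ψ x : ℝ) : ℂ))) 1).re *
          (Real.sqrt x + (Real.sqrt x)⁻¹)) :
    Summit.RiemannHypothesis := by
  by_contra hRH
  obtain ⟨ρ, hρ, h1, h2⟩ := exists_zero_re_gt_half_of_not_riemannHypothesis hRH
  obtain ⟨ρ₀, h0, hρ₀, -, hray⟩ := exists_rightmost_zero_of_offline_zero hρ h1 h2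
  -- the bump: radius `r = 1/(8(|ρ₀ − ½| + 2))` (as in `HandoffBottomDropProof.exists_weilGroundEnergy_lt_of_zero`)
  set r : ℝ := 1 / (8 * (‖ρ₀ - 1 / 2‖ + 2)) with hr
  have hn0 : 0 ≤ ‖ρ₀ - 1 / 2‖ := norm_nonneg _
  have hr0 : 0 < r := by positivity
  obtain ⟨ψ₀, hψ⟩ : ∃ ψ₀ : ContDiffBump (0 : ℝ), ψ₀.rOut = r := ⟨⟨r / 2, r, by positivity, by linarith⟩, rfl⟩
  have hr16 : r ≤ 1 / 16 := one_div_le_one_div_of_le (by norm_num) (by linarith)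
  have hr1 : ψ₀.rOut < Real.log 2 / 4 := by
    rw [hψ]; linarith [Real.log_two_gt_d9]
  have hr2 : 4 * ψ₀.rOut * ‖ρ₀ - 1 / 2‖ < 1 := by
    rw [hψ, hr]
    rw [show 4 * (1 / (8 * (‖ρ₀ - 1 / 2‖ + 2))) * ‖ρ₀ - 1 / 2‖ = ‖ρ₀ - 1 / 2‖ / (2 * (‖ρ₀ - 1 / 2‖ + 2)) by
      field_simp; ring]
    rw [div_lt_one (by positivity)]
    linarith
  obtain ⟨K₀, X₁, hX₁, hK⟩ := h ψ₀ (by rw [hψ]; exact hr16)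
  have hK₀ : ∀ x : ℝ, X₁ < x →
      0 ≤ K₀ + (weilMellin (weilConv (fun x : ℝ ↦ ((ψ₀ x : ℝ) : ℂ)) (weilReflect fun x : ℝ ↦ ((ψ₀ x : ℝ) : ℂ))) 1).re *
          (Real.sqrt x + (Real.sqrt x)⁻¹) -
        (fun x : ℝ ↦ ∑' n : ℕ, (Λ n : ℝ) / Real.sqrt n * (∫ u : ℝ, ψ₀ u * ψ₀ (u - (Real.log n - Real.log x)))) x :=
    fun x hx ↦ by linarith [hK x hx]
  exact false_of_mellin_eq_logDerivZeta (K := (K₀ : ℂ))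
    (M := ((weilMellin (weilConv (fun x : ℝ ↦ ((ψ₀ x : ℝ) : ℂ)) (weilReflect fun x : ℝ ↦ ((ψ₀ x : ℝ) : ℂ))) 1).re : ℂ))
    (Φt := fun s : ℂ ↦ weilMellin (weilConv (fun x : ℝ ↦ ((ψ₀ x : ℝ) : ℂ)) (weilReflect fun x : ℝ ↦ ((ψ₀ x : ℝ) : ℂ)))
      (s + 1 / 2))
    (measurable_comparison ψ₀ K₀) (by norm_num : (1 : ℝ) / 2 ≤ 3) (integrableOn_comparison ψ₀ K₀) hX₁ hK₀
    (differentiable_Phi ψ₀) (Phi_half ψ₀) (fun s hs ↦ mellinIoi_comparison ψ₀ hr1 K₀ hs) h0 hρ₀ hray (Phi_ne_zero ψ₀ hr2)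

/-- **(⟹) Under RH the one-sided (indeed two-sided) shadow holds for every bump**, with `X₁ = e^{2r}` and theory-2's constant
`K₀ = Re Q(ψ) + C_A(ψ)/2` (`comparison_nonneg` with `C = 0`: RH gives `ε ≥ 0` on every window). [cite: Bombieri2000Weil, Thm. 2 (⇒); MontgomeryVaughan2007, §15.1] -/
theorem oneSidedShadow_of_riemannHypothesis (hRH : Summit.RiemannHypothesis) (ψ : ContDiffBump (0 : ℝ)) :
    ∃ K₀ X₁ : ℝ, 1 ≤ X₁ ∧ ∀ x : ℝ, X₁ < x →
      (fun x : ℝ ↦ ∑' n : ℕ, (Λ n : ℝ) / Real.sqrt n * (∫ u : ℝ, ψ u * ψ (u - (Real.log n - Real.log x)))) x ≤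
        K₀ + (weilMellin (weilConv (fun x : ℝ ↦ ((ψ x : ℝ) : ℂ)) (weilReflect fun x : ℝ ↦ ((ψ x : ℝ) : ℂ))) 1).re *
          (Real.sqrt x + (Real.sqrt x)⁻¹) := by
  have hC : ∀ t : ℝ, 0 < t → -(0 : ℝ) ≤ weilGroundEnergy t := fun t ht ↦ by
    rw [neg_zero]
    exact (weilGroundEnergy_nonneg_iff_holds ht).2 (MotivicDoor.Rungs.rung_of_riemannHypothesis hRH ht)
  obtain ⟨K₀, hK₀⟩ := comparison_nonneg ψ hC
  refine ⟨K₀, Real.exp (2 * ψ.rOut), Real.one_le_exp (by linarith [ψ.rOut_pos]), fun x hx ↦ ?_⟩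
  linarith [hK₀ x hx]

/-- **`RH ⟺` THE ONE-SIDED ARITHMETIC SHADOW.** `RH` holds iff for every bump `ψ` at `0` of outer radius `≤ 1/16` there are `K₀` and
`X₁ ≥ 1` with `Σ_n Λ(n)n^{−1/2}φ_ψ(log(n/x)) ≤ K₀ + Re φ̂_ψ(1)·(√x + 1/√x)` for all `x > X₁` (`φ_ψ = ψ ⋆ ψ̃`): the smoothed `√x`-normalised
Chebyshev sums never exceed their main term by more than a constant. Compare `HandoffPrimeShadow.abs_chebyshev_sub_main_le`: the window
`WeilPositivityOn a` certifies the TWO-sided version, with the sharp constant `Q(ψ)`, for all `x ≤ e^{2a − 2r}` — the handoff ladder is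
this criterion read scale by scale. [cite: MontgomeryVaughan2007, §15.1 Thm 15.2 (Landau's method); Bombieri2000Weil, Thm. 2; this track, ATTEMPT-11 §2] -/
theorem riemannHypothesis_iff_oneSidedShadow :
    Summit.RiemannHypothesis ↔
      ∀ ψ : ContDiffBump (0 : ℝ), ψ.rOut ≤ 1 / 16 → ∃ K₀ X₁ : ℝ, 1 ≤ X₁ ∧ ∀ x : ℝ, X₁ < x →
        (fun x : ℝ ↦ ∑' n : ℕ, (Λ n : ℝ) / Real.sqrt n * (∫ u : ℝ, ψ u * ψ (u - (Real.log n - Real.log x)))) x ≤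
          K₀ + (weilMellin (weilConv (fun x : ℝ ↦ ((ψ x : ℝ) : ℂ)) (weilReflect fun x : ℝ ↦ ((ψ x : ℝ) : ℂ))) 1).re *
            (Real.sqrt x + (Real.sqrt x)⁻¹) :=
  ⟨fun hRH ψ _ ↦ oneSidedShadow_of_riemannHypothesis hRH ψ, riemannHypothesis_of_oneSidedShadow⟩

/-- **The window-to-criterion bridge, in the criterion's own variables.** `WeilPositivityOn a` (`a > 0`) gives, for every bump of radius
`r` and every `x` with `e^{2r} < x` and `(log x)/2 + r ≤ a`, BOTH one-sided bounds with the sharp constant: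
`|F_ψ(x) − Re φ̂(1)(√x + 1/√x)| ≤ Re Q(ψ) + 8r·M((log x)/2 − r)·∫ψ²`. [this track, ATTEMPT-11 §1–§2] -/
theorem abs_F_sub_main_le_of_weilPositivityOn (ψ : ContDiffBump (0 : ℝ)) {a x : ℝ} (hW : WeilPositivityOn a)
    (hx : Real.exp (2 * ψ.rOut) < x) (hxa : Real.log x / 2 + ψ.rOut ≤ a) :
    |(fun x : ℝ ↦ ∑' n : ℕ, (Λ n : ℝ) / Real.sqrt n * (∫ u : ℝ, ψ u * ψ (u - (Real.log n - Real.log x)))) x -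
        (weilMellin (weilConv (fun x : ℝ ↦ ((ψ x : ℝ) : ℂ)) (weilReflect fun x : ℝ ↦ ((ψ x : ℝ) : ℂ))) 1).re *
          (Real.sqrt x + (Real.sqrt x)⁻¹)| ≤
      (weilQuadratic (fun x : ℝ ↦ ((ψ x : ℝ) : ℂ))).re +
        8 * ψ.rOut * archGapBound (Real.log x / 2 - ψ.rOut) * ∫ y : ℝ, ψ y ^ 2 := by
  have hx0 : 0 < x := lt_trans (Real.exp_pos _) hx
  have hL : 2 * ψ.rOut < Real.log x := (Real.lt_log_iff_exp_lt hx0).2 hx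
  have h := abs_chebyshev_sub_main_le ψ hL (hW.mono hxa)
  have h1 : Real.exp (Real.log x / 2) = Real.sqrt x := by
    rw [Real.sqrt_eq_rpow, Real.rpow_def_of_pos hx0]
    ring_nf
  have h2 : Real.exp (-(Real.log x / 2)) = (Real.sqrt x)⁻¹ := by rw [Real.exp_neg, h1]
  rw [re_tsum_eq_F ψ, Real.exp_log hx0, h1, h2] at h
  rwa [mul_comm] at h

end Summit.RiemannHypothesis.RiemannHypothesis.Theorems.HandoffPrimeShadow

end
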